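import Mathlib
import Summits.KontsevichZagierPeriods.Zeta5Search.SecondDigitWProof
import Summits.KontsevichZagierPeriods.Zeta5Search.UniversalDigitV
import Summits.KontsevichZagierPeriods.Zeta5Search.RhoResidueIdentitiesProof
import Summits.KontsevichZagierPeriods.Zeta5Search.HarmonicResidue
import HarnessLib

/-!
# ζ(5) search — the CLASSWISE SECOND-DIGIT LEMMA for `V_x` is a THEOREM (gen-2 g10's (V2), `SecondDigitV`)

Cell `pub-zeta5` (HONEST FRAMING: systematic search; no irrationality claim unless certified), typer seat generation 11.
Discharges BY NAME `SecondOrder.SecondDigitV` of `Zeta5Search/SecondOrderDigit.lean` (gen-2 g10, REPORT-gen2-g10 §1 (V2), exact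
check 115,590 classes with `E ≤ −2`): for a residue class with base `x < p` and `E_x ≤ −2` (window `5 ≤ p`, `b₀ + 2 < p²`),
**`v_p( V_x − (−p)^{E_x} ĝ_x (v̂_x − p φ_x v̂₂_x) ) ≥ E_x + 2`**.
Proof (REPORT §1): split `H_s^{(σ)} = p^{−σ} H^{(σ)}_{ℓ_s} + N_{s,σ}` (`N` `p`-integral, `padicNorm_harm_sub_level_le_one`); the first
part carries the second-order digit of `c_{σ−1,s}` (`leadingDigit₂`, units moved to the base by `padicNorm_gHat_sub_second_le`, G1 and
`φ_s ≡ φ_x`); in the second part only `σ = 1` reaches the order `E+1`, where **`N_{s,1} ≡ H_x (mod p)`** (`padicNorm_harmN_sub_le`,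
`HarmonicResidue.lean`) and `Σ_{poles} ρ_{s,1} = 0` (`E ≤ −2`,
`rhoResidueIdentities_holds`).  `p`-adic valuations of rational numbers; nothing here concerns irrationality.
-/

noncomputable section

open Finset PowerSeries

namespace Summit.KontsevichZagierPeriods.Zeta5Search.SecondOrder

open Summit.KontsevichZagierPeriods.Zeta5Search.DualSeries (InBox)
open Summit.KontsevichZagierPeriods.Zeta5Search.WedgeDictionary (pfData)
open Summit.KontsevichZagierPeriods.Zeta5Search.CasoratianValuation (InPolytope)
open Summit.KontsevichZagierPeriods.Zeta5Search.ClusterValuation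
open Summit.KontsevichZagierPeriods.Zeta5Search.PadicSeries
open Summit.KontsevichZagierPeriods.Zeta5Search.CellA (padicNorm_classRho_le_one pfData_eq_zero_of_order_le gHat_classCongr
  padicNorm_pow_eq padicNorm_mul_sub_mul_le padicNorm_p padicNorm_inv_sub_inv_le padicNorm_harm_sub_level_le_one harm_succ
  sum_Icc_one_eq_sum_range_six padicNorm_harm_le_one padicNorm_p_pow)
open Literature.NumberTheory.Transcendental.BallRivoal (harm)

variable {p : ℕ} [hp : Fact p.Prime]

/-! ### (V2) -/

/-- **(V2) — the classwise second digit of `V_x` (gen-2 g10's `SecondDigitV`) is a theorem.** -/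
theorem secondDigitV_holds : SecondDigitV := by
  intro b p x hb hprime hp5 hwin hx hpole hE2 hne
  haveI : Fact p.Prime := ⟨hprime⟩
  obtain ⟨hbox, -, -, hn⟩ := thmA_data b hb hwin
  have h0 : 0 ≤ b 0 := hbox.1
  have hp2 : p ≠ 2 := by omega
  have hp0 : (p : ℚ) ≠ 0 := Nat.cast_ne_zero.2 hprime.ne_zero
  have hp' : (-(p : ℚ)) ≠ 0 := neg_ne_zero.2 hp0
  have hxmem : x ∈ classSet b p x := base_mem_classSet b hx hpole
  set E := classExp b p x with hE
  set g := gHat b p x with hg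
  set φ := phiHat b p x with hφ
  set Hx := harm 1 x with hHx
  -- the model summands
  set F1 : ℕ → ℕ → ℚ := fun s σ => (-1 : ℚ) ^ σ * classRho b p s σ * harm σ (s / p) with hF1
  set F2 : ℕ → ℕ → ℚ := fun s σ => (-1 : ℚ) ^ σ * (((s / p : ℕ) : ℚ) * classRho b p s σ
      + (if (σ : ℤ) + 1 ≤ -netExp b s then classRho b p s (σ + 1) else 0)) * harm σ (s / p) with hF2
  -- v̂ and v̂₂ as double sums over the whole class and `o < 6`
  have h6 : ∀ s, (-netExp b s).toNat ≤ 6 := fun s => by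
    have := blockCount_le b s; unfold netExp; split_ifs <;> omega
  have hIcc : ∀ (F : ℕ → ℕ → ℚ) s, (∑ σ ∈ Icc 1 (-netExp b s).toNat, F s σ) =
      ∑ o ∈ range 6, (if (o : ℤ) + 1 ≤ -netExp b s then F s (o + 1) else 0) := by
    intro F s
    rw [sum_Icc_one_eq_sum_range_six (h6 s)]
    refine sum_congr rfl fun o _ => ?_
    have : (o + 1 ≤ (-netExp b s).toNat) ↔ ((o : ℤ) + 1 ≤ -netExp b s) := by omega
    simp only [this]
  have hpoles : ∀ (F : ℕ → ℕ → ℚ), (∑ s ∈ classPoles b p x, ∑ σ ∈ Icc 1 (-netExp b s).toNat, F s σ) =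
      ∑ s ∈ classSet b p x, ∑ o ∈ range 6, (if (o : ℤ) + 1 ≤ -netExp b s then F s (o + 1) else 0) := by
    intro F
    rw [classPoles, sum_filter]
    refine sum_congr rfl fun s _ => ?_
    split_ifs with hpole'
    · exact hIcc F s
    · refine (sum_eq_zero fun o _ => ?_).symm
      rw [if_neg (by omega)]
  have hv : vHat b p x = ∑ s ∈ classSet b p x, ∑ o ∈ range 6,
      (if (o : ℤ) + 1 ≤ -netExp b s then F1 s (o + 1) else 0) := by
    rw [vHat]; exact hpoles F1
  have hv2 : vHat2 b p x = ∑ s ∈ classSet b p x, ∑ o ∈ range 6,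
      (if (o : ℤ) + 1 ≤ -netExp b s then F2 s (o + 1) else 0) := by
    rw [vHat2]; exact hpoles F2
  -- the termwise model and the correction at σ = 1
  set A : ℕ → ℕ → ℚ := fun s o => pfData b o s * harm (o + 1) s - (-(p : ℚ)) ^ E * g *
      ((if (o : ℤ) + 1 ≤ -netExp b s then F1 s (o + 1) else 0)
        - (p : ℚ) * φ * (if (o : ℤ) + 1 ≤ -netExp b s then F2 s (o + 1) else 0)) with hA
  set Cr : ℕ → ℕ → ℚ := fun s o =>
      if o = 0 ∧ netExp b s < 0 then (-(p : ℚ)) ^ (E + 1) * g * Hx * classRho b p s 1 else 0 with hCr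
  have hsplit : classV b p x - (-(p : ℚ)) ^ E * g * (vHat b p x - (p : ℚ) * φ * vHat2 b p x) =
      ∑ s ∈ classSet b p x, ∑ o ∈ range 6, A s o := by
    rw [hv, hv2, classV, mul_sum, ← sum_sub_distrib, mul_sum, ← sum_sub_distrib]
    refine sum_congr rfl fun s _ => ?_
    rw [mul_sum, ← sum_sub_distrib, mul_sum, ← sum_sub_distrib]
  -- the correction sums to zero: `Σ_{poles} ρ_{s,1} = 0` (E ≤ -2)
  have hres : ∑ s ∈ classPoles b p x, classRho b p s 1 = 0 :=
    (rhoResidueIdentities_holds b p x hb hprime hp5 hwin hx).1 hE2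
  have hCsum : ∑ s ∈ classSet b p x, ∑ o ∈ range 6, Cr s o = 0 := by
    have hinner : ∀ s, ∑ o ∈ range 6, Cr s o =
        if netExp b s < 0 then (-(p : ℚ)) ^ (E + 1) * g * Hx * classRho b p s 1 else 0 := by
      intro s
      rw [sum_eq_single 0]
      · simp only [hCr, true_and]
      · intro o _ ho; simp only [hCr, ho, false_and, if_false]
      · intro h; exact absurd (mem_range.2 (by norm_num)) h
    rw [sum_congr rfl fun s _ => hinner s, ← sum_filter]
    change ∑ s ∈ classPoles b p x, _ = 0
    rw [← mul_sum, hres, mul_zero]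
  have hsplit' : classV b p x - (-(p : ℚ)) ^ E * g * (vHat b p x - (p : ℚ) * φ * vHat2 b p x) =
      ∑ s ∈ classSet b p x, ∑ o ∈ range 6, (A s o - Cr s o) := by
    rw [hsplit]
    have : ∑ s ∈ classSet b p x, ∑ o ∈ range 6, (A s o - Cr s o) =
        (∑ s ∈ classSet b p x, ∑ o ∈ range 6, A s o) - ∑ s ∈ classSet b p x, ∑ o ∈ range 6, Cr s o := by
      rw [← sum_sub_distrib]; refine sum_congr rfl fun s _ => sum_sub_distrib _ _
    rw [this, hCsum, sub_zero]
  -- common norms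
  have hpowE : padicNorm p ((-(p : ℚ)) ^ E) = (p : ℚ) ^ (-E) := by
    rw [padicNorm.eq_zpow_of_nonzero (zpow_ne_zero _ hp'), padicValRat.zpow, padicValRat.neg,
      padicValRat.self hprime.one_lt, mul_one]
  have hpowE1 : padicNorm p ((-(p : ℚ)) ^ (E + 1)) = (p : ℚ) ^ (-(E + 1)) := by
    rw [padicNorm.eq_zpow_of_nonzero (zpow_ne_zero _ hp'), padicValRat.zpow, padicValRat.neg,
      padicValRat.self hprime.one_lt, mul_one]
  have hgx1 : padicNorm p g ≤ 1 := (padicNorm_gHat_class b hb hp5 hx hxmem hxmem).1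
  have hφ1 : padicNorm p φ ≤ 1 := padicNorm_phiHat_le_one b hp2 x
  have hHx1 : padicNorm p Hx ≤ 1 := padicNorm_harm_le_one hx 1
  have hp1le : (p : ℚ) ^ (-(1 : ℤ)) ≤ 1 := zpow_le_one_of_nonpos₀ one_le_p (by norm_num)
  -- termwise bound `p^{-(E+2)}`
  have hterm : ∀ s ∈ classSet b p x, ∀ o ∈ range 6, padicNorm p (A s o - Cr s o) ≤ (p : ℚ) ^ (-(E + 2)) := by
    intro s hs o ho
    have hsn : s ≤ (b 0).toNat := ((mem_classSet_iff b x s).1 hs).1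
    have hsx : s % p = x := by rw [(mem_filter.1 hs).2, Nat.mod_eq_of_lt hx]
    have ho' := mem_range.1 ho
    have hEs : classExp b p s = E := classExp_eq_of_mem hs
    by_cases hord : (o : ℤ) + 1 ≤ -netExp b s
    · -- `s` is a pole of order ≥ σ = o + 1
      have hAs : A s o = pfData b o s * harm (o + 1) s - (-(p : ℚ)) ^ E * g *
          ((-1 : ℚ) ^ (o + 1) * classRho b p s (o + 1) * harm (o + 1) (s / p) - (p : ℚ) * φ *
            ((-1 : ℚ) ^ (o + 1) * (((s / p : ℕ) : ℚ) * classRho b p s (o + 1)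
              + (if ((o + 1 : ℕ) : ℤ) + 1 ≤ -netExp b s then classRho b p s (o + 1 + 1) else 0)) * harm (o + 1) (s / p))) := by
        simp only [hA, hF1, hF2, if_pos hord]
      set σ := o + 1 with hσ
      set c := pfData b o s with hc
      set gs := gHat b p s with hgs
      set φs := phiHat b p s with hφs
      set ρ := classRho b p s σ with hρdef
      set ρ' : ℚ := if (σ : ℤ) + 1 ≤ -netExp b s then classRho b p s (σ + 1) else 0 with hρ'
      set Hs := harm σ s with hHs
      set Hl := harm σ (s / p) with hHl
      set ℓ : ℚ := ((s / p : ℕ) : ℚ) with hℓ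
      set N := Hs - Hl / (p : ℚ) ^ σ with hN
      -- ingredients
      have hD : padicNorm p (c - (-(p : ℚ)) ^ ((σ : ℤ) + E) * gs * (ρ - (p : ℚ) * φs * ρ')) ≤
          (p : ℚ) ^ (-((σ : ℤ) + E + 2)) := by
        have h := leadingDigit₂ b hb hp5 hwin hsn (σ := σ) (by omega) (by omega)
        rw [hEs, show σ - 1 = o by omega] at h
        exact h
      have hcA : padicNorm p c ≤ (p : ℚ) ^ (-((σ : ℤ) + E)) := by
        refine padicNorm_le_of_val fun hne' => ?_
        have := clusterBound_holds b p s o hb hprime (by omega) hwin hsn ho' hne'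
        rw [hEs] at this; push_cast [hσ]; linarith
      have hρn : padicNorm p ρ ≤ 1 := padicNorm_classRho_le_one b h0 hsn hn hp2 σ
      have hρ'n : padicNorm p ρ' ≤ 1 := by
        rw [hρ']; split_ifs
        · exact padicNorm_classRho_le_one b h0 hsn hn hp2 (σ + 1)
        · simp
      have hgs1 : padicNorm p gs ≤ 1 := (padicNorm_gHat_class b hb hp5 hx hs hxmem).1
      have hgg : padicNorm p (gs - g) ≤ (p : ℚ) ^ (-(1 : ℤ)) := (padicNorm_gHat_class b hb hp5 hx hs hxmem).2
      have hφφ : padicNorm p (φs - φ) ≤ (p : ℚ) ^ (-(1 : ℤ)) := padicNorm_phiHat_sub_le b hp2 hs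
      have hg2 : padicNorm p (gs - g * (1 - ℓ * p * φ)) ≤ (p : ℚ) ^ (-(2 : ℤ)) :=
        padicNorm_gHat_sub_second_le b hp2 hx hs
      have hgφ : padicNorm p (gs * φs - g * φ) ≤ (p : ℚ) ^ (-(1 : ℤ)) := padicNorm_mul_sub_mul_le hgs1 hφ1 hgg hφφ
      have hlp : s / p < p := Nat.div_lt_of_lt_mul (by nlinarith [hsn, hn])
      have hHl1 : padicNorm p Hl ≤ 1 := padicNorm_harm_le_one hlp σ
      have hN1 : padicNorm p N ≤ 1 := padicNorm_harm_sub_level_le_one σ s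
      have hB2 : padicNorm p ((gs - g * (1 - ℓ * p * φ)) * ρ - (p : ℚ) * ρ' * (gs * φs - g * φ)) ≤ (p : ℚ) ^ (-(2 : ℤ)) := by
        refine (padicNorm.sub (p := p)).trans (max_le ?_ ?_)
        · rw [padicNorm.mul]
          calc _ ≤ (p : ℚ) ^ (-(2 : ℤ)) * 1 := mul_le_mul hg2 hρn (padicNorm.nonneg _) (zpow_p_nonneg _)
            _ = _ := mul_one _
        · rw [padicNorm.mul, padicNorm.mul, padicNorm_p]
          calc (p : ℚ) ^ (-(1 : ℤ)) * padicNorm p ρ' * padicNorm p (gs * φs - g * φ)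
              ≤ (p : ℚ) ^ (-(1 : ℤ)) * 1 * (p : ℚ) ^ (-(1 : ℤ)) :=
                mul_le_mul (mul_le_mul_of_nonneg_left hρ'n (zpow_p_nonneg _)) hgφ (padicNorm.nonneg _)
                  (mul_nonneg (zpow_p_nonneg _) zero_le_one)
            _ = (p : ℚ) ^ (-(2 : ℤ)) := by rw [mul_one, ← zpow_add₀ hp0]; norm_num
      -- the algebra: A − Cr = (cN − Cr) + D·Hl/p^σ + (−1)^σ (−p)^E Hl B2
      have hzpow : (-(p : ℚ)) ^ ((σ : ℤ) + E) = (-1 : ℚ) ^ σ * (p : ℚ) ^ σ * (-(p : ℚ)) ^ E := by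
        rw [zpow_add₀ hp', zpow_natCast, neg_pow]
      have eA : A s o = c * N
          + (c - (-(p : ℚ)) ^ ((σ : ℤ) + E) * gs * (ρ - (p : ℚ) * φs * ρ')) / (p : ℚ) ^ σ * Hl
          + (-1 : ℚ) ^ σ * (-(p : ℚ)) ^ E * Hl * ((gs - g * (1 - ℓ * p * φ)) * ρ - (p : ℚ) * ρ' * (gs * φs - g * φ)) := by
        rw [hAs, hN, hzpow]; field_simp; ring
      -- the three generic pieces
      have hP2 : padicNorm p ((c - (-(p : ℚ)) ^ ((σ : ℤ) + E) * gs * (ρ - (p : ℚ) * φs * ρ')) / (p : ℚ) ^ σ * Hl) ≤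
          (p : ℚ) ^ (-(E + 2)) := by
        rw [padicNorm.mul, padicNorm.div, padicNorm_p_pow]
        calc _ / ((p : ℚ) ^ σ)⁻¹ * padicNorm p Hl ≤ (p : ℚ) ^ (-((σ : ℤ) + E + 2)) / ((p : ℚ) ^ σ)⁻¹ * 1 :=
              mul_le_mul (div_le_div_of_nonneg_right hD (by positivity)) hHl1 (padicNorm.nonneg _)
                (div_nonneg (zpow_p_nonneg _) (by positivity))
          _ = (p : ℚ) ^ (-(E + 2)) := by
              rw [mul_one, div_inv_eq_mul, ← zpow_natCast, ← zpow_add₀ hp0]; ring_nf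
      have hP3 : padicNorm p ((-1 : ℚ) ^ σ * (-(p : ℚ)) ^ E * Hl *
          ((gs - g * (1 - ℓ * p * φ)) * ρ - (p : ℚ) * ρ' * (gs * φs - g * φ))) ≤ (p : ℚ) ^ (-(E + 2)) := by
        rw [padicNorm.mul, padicNorm.mul, padicNorm.mul, hpowE]
        have h1 : padicNorm p ((-1 : ℚ) ^ σ) = 1 := by rw [padicNorm_pow_eq, padicNorm.neg, padicNorm.one, one_pow]
        rw [h1, one_mul]
        calc (p : ℚ) ^ (-E) * padicNorm p Hl * _ ≤ (p : ℚ) ^ (-E) * 1 * (p : ℚ) ^ (-(2 : ℤ)) :=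
              mul_le_mul (mul_le_mul_of_nonneg_left hHl1 (zpow_p_nonneg _)) hB2 (padicNorm.nonneg _)
                (mul_nonneg (zpow_p_nonneg _) zero_le_one)
          _ = (p : ℚ) ^ (-(E + 2)) := by rw [mul_one, ← zpow_add₀ hp0]; ring_nf
      by_cases ho0 : o = 0
      · -- σ = 1: the correction term refines `c·N`
        have hσ1 : σ = 1 := by omega
        have hneg : netExp b s < 0 := by omega
        have hCrs : Cr s o = (-(p : ℚ)) ^ (E + 1) * g * Hx * ρ := by
          simp only [hCr, ho0, hneg, and_self, if_true, hρdef, hσ1]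
        -- first-order Theorem B at σ = 1
        have hB1 : padicNorm p (c - (-(p : ℚ)) ^ (E + 1) * gs * ρ) ≤ (p : ℚ) ^ (-(E + 2)) := by
          refine padicNorm_le_of_val fun hne' => ?_
          have := leadingDigit_holds b p s 1 hb hprime hp5 hwin hsn le_rfl (by omega)
            (by rw [hEs, show ((1 : ℕ) : ℤ) + E = E + 1 by ring, show 1 - 1 = o by omega, ← hσ1]; exact hne')
          rw [hEs, show ((1 : ℕ) : ℤ) + E = E + 1 by ring, show 1 - 1 = o by omega, ← hσ1] at this
          linarith
        -- `N_{s,1} ≡ H_x`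
        have hNH : padicNorm p (N - Hx) ≤ (p : ℚ) ^ (-(1 : ℤ)) := by
          have h := padicNorm_harmN_sub_le (p := p) hp2 s
          rw [hsx] at h
          rw [hN, hHs, hHl, hσ1, hHx]
          exact h
        have e1 : c * N - Cr s o = (c - (-(p : ℚ)) ^ (E + 1) * gs * ρ) * N
            + (-(p : ℚ)) ^ (E + 1) * (gs - g) * ρ * N + (-(p : ℚ)) ^ (E + 1) * g * ρ * (N - Hx) := by
          rw [hCrs]; ring
        have hP1 : padicNorm p (c * N - Cr s o) ≤ (p : ℚ) ^ (-(E + 2)) := by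
          rw [e1]
          refine (padicNorm.nonarchimedean (p := p)).trans
            (max_le ((padicNorm.nonarchimedean (p := p)).trans (max_le ?_ ?_)) ?_)
          · rw [padicNorm.mul]
            calc _ ≤ (p : ℚ) ^ (-(E + 2)) * 1 := mul_le_mul hB1 hN1 (padicNorm.nonneg _) (zpow_p_nonneg _)
              _ = _ := mul_one _
          · rw [padicNorm.mul, padicNorm.mul, padicNorm.mul, hpowE1]
            calc (p : ℚ) ^ (-(E + 1)) * padicNorm p (gs - g) * padicNorm p ρ * padicNorm p N
                ≤ (p : ℚ) ^ (-(E + 1)) * (p : ℚ) ^ (-(1 : ℤ)) * 1 * 1 :=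
                  mul_le_mul (mul_le_mul (mul_le_mul_of_nonneg_left hgg (zpow_p_nonneg _)) hρn (padicNorm.nonneg _)
                    (mul_nonneg (zpow_p_nonneg _) (zpow_p_nonneg _))) hN1 (padicNorm.nonneg _)
                    (mul_nonneg (mul_nonneg (zpow_p_nonneg _) (zpow_p_nonneg _)) zero_le_one)
              _ = (p : ℚ) ^ (-(E + 2)) := by rw [mul_one, mul_one, ← zpow_add₀ hp0]; ring_nf
          · rw [padicNorm.mul, padicNorm.mul, padicNorm.mul, hpowE1]
            calc (p : ℚ) ^ (-(E + 1)) * padicNorm p g * padicNorm p ρ * padicNorm p (N - Hx)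
                ≤ (p : ℚ) ^ (-(E + 1)) * 1 * 1 * (p : ℚ) ^ (-(1 : ℤ)) :=
                  mul_le_mul (mul_le_mul (mul_le_mul_of_nonneg_left hgx1 (zpow_p_nonneg _)) hρn (padicNorm.nonneg _)
                    (mul_nonneg (zpow_p_nonneg _) zero_le_one)) hNH (padicNorm.nonneg _)
                    (mul_nonneg (mul_nonneg (zpow_p_nonneg _) zero_le_one) zero_le_one)
              _ = (p : ℚ) ^ (-(E + 2)) := by rw [mul_one, mul_one, ← zpow_add₀ hp0]; ring_nf
        have e2 : A s o - Cr s o = (c * N - Cr s o)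
            + (c - (-(p : ℚ)) ^ ((σ : ℤ) + E) * gs * (ρ - (p : ℚ) * φs * ρ')) / (p : ℚ) ^ σ * Hl
            + (-1 : ℚ) ^ σ * (-(p : ℚ)) ^ E * Hl * ((gs - g * (1 - ℓ * p * φ)) * ρ - (p : ℚ) * ρ' * (gs * φs - g * φ)) := by
          rw [eA]; ring
        rw [e2]
        exact (padicNorm.nonarchimedean (p := p)).trans
          (max_le ((padicNorm.nonarchimedean (p := p)).trans (max_le hP1 hP2)) hP3)
      · -- σ ≥ 2: no correction, `‖cN‖ ≤ p^{-(σ+E)} ≤ p^{-(E+2)}`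
        have hCrs : Cr s o = 0 := by simp only [hCr, ho0, false_and, if_false]
        have hP1 : padicNorm p (c * N) ≤ (p : ℚ) ^ (-(E + 2)) := by
          rw [padicNorm.mul]
          calc padicNorm p c * padicNorm p N ≤ (p : ℚ) ^ (-((σ : ℤ) + E)) * 1 :=
                mul_le_mul hcA hN1 (padicNorm.nonneg _) (zpow_p_nonneg _)
            _ ≤ (p : ℚ) ^ (-(E + 2)) := by rw [mul_one]; exact zpow_le_zpow_right₀ one_le_p (by omega)
        rw [hCrs, sub_zero, eA]
        exact (padicNorm.nonarchimedean (p := p)).trans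
          (max_le ((padicNorm.nonarchimedean (p := p)).trans (max_le hP1 hP2)) hP3)
    · -- no pole of order ≥ o + 1 at `s`: everything vanishes
      have hAs : A s o = 0 := by
        simp only [hA, if_neg hord]
        rw [pfData_eq_zero_of_order_le b hb hsn ho' (by omega)]; ring
      have hCrs : Cr s o = 0 := by
        have hno : ¬ (o = 0 ∧ netExp b s < 0) := by
          rintro ⟨rfl, hneg⟩
          exact hord (by push_cast; omega)
        simp only [hCr, hno, if_false]
      rw [hAs, hCrs, sub_zero, padicNorm.zero]; exact zpow_p_nonneg _
  apply val_ge_of_padicNorm_le hne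
  rw [hsplit']
  exact padicNorm.sum_le' (fun s hs => padicNorm.sum_le' (fun o ho => hterm s hs o ho) (zpow_p_nonneg _)) (zpow_p_nonneg _)

end Summit.KontsevichZagierPeriods.Zeta5Search.SecondOrder

end
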